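import Summits.AtomisticToContinuum.BoseEinsteinCondensation.Theses.BECBathMassLiouville
import Summits.AtomisticToContinuum.BoseEinsteinCondensation.Theorems.BECGroundStateSOSPeriodicIRBoundWFPotCross

/-!
# Route `BECBathMassLiouville` — support item `LightBathCoherence` (stmt-AtomisticToContinuum-13802):
non-vacuity of the near-minimiser layer

Supports (does not close) stmt-AtomisticToContinuum-13802. The item quantifies over `δ`-near-minimisers
of the mass-deformed torus energy
`E_η(φ) = ∫_{cell^{N+1}} |∇₀φ|² + η⁻¹ ∑_{j≥1} |∇ⱼφ|² + ∑_{i<j} v^per(xᵢ - xⱼ)|φ|²` over `C¹`,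
`Lℤ³`-periodic, cell-normalised `φ : (ℝ³)^{N+1} → ℂ`, through `E_η(ψ) ≤ ⨅ E_η + δ`. If the infimum
were `⊤` this hypothesis would hold for EVERY admissible `ψ` and the item would be trivially false
(a tagged plane wave is admissible and has zero constant-mode weight). Here: under the item's
hypotheses on `v` (measurable, `∫_{ℝ³} v(|x|) dx < ∞`) the infimum is finite at every `L > 0`, `η`, `N`
— the constant state `L^{-3(N+1)/2}` is admissible (`TaggedPeriodicTrialState.const`) and costs
`L^{-3(N+1)} ∫_{cell^{N+1}} ∑_{i<j} v^per(xᵢ - xⱼ) dX < ∞`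
(`lintegral_cellN_periodicInteraction_ne_top`: `∫_{cell} v^per = ‖v(|·|)‖₁`). So the `∃ δ ∀ ψ`
layer of the item is contentful for every admissible `v`, and for fixed `(N, L, η)` it singles out
the ground state of `H_η = -Δ₀ - η⁻¹∑ⱼΔⱼ + ∑_{i<j} v^per(xᵢ - xⱼ)` as `δ ↓ 0`.
-/

noncomputable section

namespace Summit.AtomisticToContinuum.BoseEinsteinCondensation.Theorems

open MeasureTheory Filter
open scoped ENNReal NNReal
open Literature.MathematicalPhysics.QuantumManyBody.BoseGas
open Summit.AtomisticToContinuum.BoseEinsteinCondensation.Cruxes.PeriodicIRBound.LinearPhFloorWagner.WF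
  (lintegral_cellN_periodicInteraction_ne_top measurable_periodicInteraction_tk)

namespace LightBathCoherence

variable {N : ℕ} {L : ℝ}

/-- **The infimum of the deformed energy is finite** (every box `L > 0`, every `η`, every `N`) for a
measurable profile with `∫_{ℝ³} v(|x|) dx < ∞`: it is at most the energy of the constant state,
`L^{-3(N+1)} ∫_{cell^{N+1}} ∑_{i<j} v^per(xᵢ - xⱼ) < ∞`. [folklore] -/
theorem deformedEnergy_iInf_ne_top (hL : 0 < L) {v : ℝ → ℝ≥0∞} (hv : Measurable v)
    (hint : (∫⁻ z : Space, v ‖z‖) ≠ ⊤) (η : ℝ) :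
    (⨅ (φ : Config (N + 1) → ℂ) (_ : ContDiff ℝ 1 φ ∧
        (∀ (X : Config (N + 1)) (i : Fin (N + 1)) (k : Fin 3),
          φ (X + Pi.single i (EuclideanSpace.single k L)) = φ X) ∧
        (∫⁻ X in cellN (N + 1) L, (‖φ X‖₊ : ENNReal) ^ 2) = 1),
      ∫⁻ X in cellN (N + 1) L,
        (∑ k : Fin 3, (‖fderiv ℝ φ X (Pi.single (0 : Fin (N + 1))
          (EuclideanSpace.single k (1 : ℝ)))‖₊ : ENNReal) ^ 2) +
        ENNReal.ofReal η⁻¹ * (∑ j : Fin N, ∑ k : Fin 3, (‖fderiv ℝ φ X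
          (Pi.single j.succ (EuclideanSpace.single k (1 : ℝ)))‖₊ : ENNReal) ^ 2) +
        periodicInteraction v L X * (‖φ X‖₊ : ENNReal) ^ 2) ≠ ⊤ := by
  set Ω := TaggedPeriodicTrialState.const N hL with hΩ
  refine ne_top_of_le_ne_top ?_ (iInf₂_le Ω.ψ ⟨Ω.contDiff, Ω.periodic, Ω.norm_eq⟩)
  have hψΩ : Ω.ψ = fun _ => (((Real.sqrt (L ^ 3))⁻¹ : ℂ) ^ (N + 1)) := rfl
  simp only [hψΩ, fderiv_const_apply, zero_apply, nnnorm_zero,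
    ENNReal.coe_zero, zero_pow two_ne_zero, Finset.sum_const_zero, mul_zero, zero_add]
  rw [lintegral_mul_const _ (measurable_periodicInteraction_tk hv L)]
  exact ENNReal.mul_ne_top (lintegral_cellN_periodicInteraction_ne_top hL hv hint (N + 1))
    (ENNReal.pow_ne_top ENNReal.coe_ne_top)

/-- **Non-vacuity of the item along the thermodynamic boxes**: for every admissible `v` of
`LightBathCoherence` (repulsive finite-range with `∫ v(|x|) dx < ∞`), every `ρ > 0`, `η` and `N`,
the infimum of the deformed energy on the torus of side `L = ((N+1)/ρ)^{1/3}` is finite, so its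
`δ`-near-minimisers form a proper subclass of the admissible states. [folklore] -/
theorem deformedEnergy_iInf_sideLength_ne_top {v : ℝ → ℝ≥0∞} (hv : IsRepulsiveFiniteRange v)
    (hint : (∫⁻ z : Space, v ‖z‖) ≠ ⊤) {ρ : ℝ} (hρ : 0 < ρ) (η : ℝ) (N : ℕ) :
    (⨅ (φ : Config (N + 1) → ℂ) (_ : ContDiff ℝ 1 φ ∧
        (∀ (X : Config (N + 1)) (i : Fin (N + 1)) (k : Fin 3),
          φ (X + Pi.single i (EuclideanSpace.single k (sideLength ρ (N + 1)))) = φ X) ∧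
        (∫⁻ X in cellN (N + 1) (sideLength ρ (N + 1)), (‖φ X‖₊ : ENNReal) ^ 2) = 1),
      ∫⁻ X in cellN (N + 1) (sideLength ρ (N + 1)),
        (∑ k : Fin 3, (‖fderiv ℝ φ X (Pi.single (0 : Fin (N + 1))
          (EuclideanSpace.single k (1 : ℝ)))‖₊ : ENNReal) ^ 2) +
        ENNReal.ofReal η⁻¹ * (∑ j : Fin N, ∑ k : Fin 3, (‖fderiv ℝ φ X
          (Pi.single j.succ (EuclideanSpace.single k (1 : ℝ)))‖₊ : ENNReal) ^ 2) +
        periodicInteraction v (sideLength ρ (N + 1)) X * (‖φ X‖₊ : ENNReal) ^ 2) ≠ ⊤ :=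
  deformedEnergy_iInf_ne_top
    (Real.rpow_pos_of_pos (div_pos (Nat.cast_pos.2 (Nat.succ_pos N)) hρ) _) hv.1 hint η

end LightBathCoherence

end Summit.AtomisticToContinuum.BoseEinsteinCondensation.Theorems

end
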